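import Summits.NavierStokesRegularity.NavierStokesRegularity.Theorems.TypeILiouvilleTypeIliouvilleNoTypeIIEnergyTypeISlabOfRate
import Summits.NavierStokesRegularity.NavierStokesRegularity.Theorems.TypeILiouvilleTypeIliouvilleNoTypeIINormalForm
import Literature.Analysis.FluidPDE.LocalTypeIScaling
import Literature.Analysis.FluidPDE.LocalTypeIReverseTools
import Literature.Analysis.FluidPDE.KNSSTypeII
import Literature.Analysis.FluidPDE.NSCriticalClosureBesovBounded
import Literature.Analysis.FluidPDE.TaoLocalisationHolds
import HarnessLib

/-!
# Hard core `NoTypeII` (stmt-NavierStokesRegularity-0056): NECESSITY of the registered residual S₁ at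
# unit scale — `NoTypeII ⇒ stub_energyTypeISlab (ν = 1, T = 1)`, and the LOCATION «under EEL′, S₁ ↔ NoTypeII»

Assembly over `…EnergyTypeISlabOfRate.lean` (Type-I rate on the whole lifespan ⇒ `𝐈 < ⊤` on a final slab,
`ν = 1`, `T ≥ 2`, gauged pressure):

* `typeIBound_slab_lt_top_of_rate_two_le_pressure` — the same with the GIVEN classical pressure `p`
  (Albritton–Barker's `D` is mean-free: `cknDOsc_sub_fun_time`);
* `typeIBound_slab_lt_top_of_rate_one` — lifespan `T = 1`: Leray's similarity `w(s,y) = ½ u(s/4, y/2)`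
  (lifespan `4`; `IsClassicalNSSolutionOn.nsRescale_holds`, `IsLerayHopfOn.nsRescale_holds`) and the
  scale invariance `typeIBound_nsZoom` bring the slab bound back to `(15/16, 1) × ℝ³`;
* `energyTypeISlab_unit_of_isTypeIBlowup` — per solution at `(ν, T) = (1, 1)`: maximal ∧ Leray–Hopf ∧
  rapidly decaying datum ∧ `IsTypeIBlowup u 1` ⇒ `∃ r > 0, 𝐈((1 - r², 1) × ℝ³; u, p, ∇u) < ⊤` (eventual
  rate ⇒ whole-interval rate by the slab sup bounds, `IsTypeIBlowup.exists_sqrt_mul_norm_le` +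
  `exists_forall_norm_le_of_tao2011`);
* `energyTypeISlab_unit_of_typeIliouvilleNoTypeII` — **NECESSARY by name**: `NoTypeII ⇒ S₁` at unit
  scale; with `typeIliouvilleNoTypeII_of_energyTypeISlab_unit_of_eternalLiouville` (`…NormalForm.lean`):
* `energyTypeISlab_unit_iff_typeIliouvilleNoTypeII_of_eternalLiouville` — **under EEL′ the registered
  residual (unit scale) IS the hard core**: `S₁(1,1) ↔ NoTypeII`.

WHAT THIS IS NOT: not NS; S₁ and EEL′ stay OPEN. [folklore]
-/

noncomputable section

-- the summit and its single problem share the name (D-0017 nested layout)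
set_option linter.dupNamespace false

open MeasureTheory Set Function Filter TopologicalSpace Metric
open scoped Topology NNReal ENNReal

namespace Summit.NavierStokesRegularity.NavierStokesRegularity.Theorems.TypeIliouvilleNoTypeII.EnergySlab

open Literature.Analysis Literature.Analysis.FluidPDE
open Summit.NavierStokesRegularity.NavierStokesRegularity.Theses.TypeILiouville (TypeIliouvilleNoTypeII)
open Summit.NavierStokesRegularity.NavierStokesRegularity.Theorems.TypeIliouvilleNoTypeII.EternalSplit

variable {T : ℝ} {u : ℝ → EuclideanSpace ℝ (Fin 3) → EuclideanSpace ℝ (Fin 3)}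
  {p : ℝ → EuclideanSpace ℝ (Fin 3) → ℝ}

/-! ### The given pressure instead of the gauged one -/

/-- `𝐈` does not see a function of time subtracted from a classical pressure: on a slab inside
`(0, T) × ℝ³`, `𝐈(ω; u, p, G) ≤ 𝐈(ω; u, p - c(t), G)` (in fact equality; `D` is mean-free and the slices
of `p` are continuous, hence integrable on balls). [folklore] -/
theorem typeIBound_le_typeIBound_sub_fun_time (hsol : IsClassicalNSSolutionOn (Ico 0 T) 1 0 u p)
    {a : ℝ} (ha : 0 ≤ a) (c : ℝ → ℝ)
    (G : ℝ → EuclideanSpace ℝ (Fin 3) → EuclideanSpace ℝ (Fin 3) →L[ℝ] EuclideanSpace ℝ (Fin 3)) :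
    typeIBound (Ioo a T ×ˢ (univ : Set (EuclideanSpace ℝ (Fin 3)))) u p G ≤
      typeIBound (Ioo a T ×ˢ (univ : Set (EuclideanSpace ℝ (Fin 3)))) u (fun t x => p t x - c t) G := by
  refine typeIBound_le_iff.2 fun r hr z hz => ?_
  obtain ⟨h1, h2⟩ := margins_of_subset_slab hr hz
  have hD : cknDOsc r z (fun t x => p t x - c t) = cknDOsc r z p := by
    refine cknDOsc_sub_fun_time hr c ?_
    refine (ae_restrict_iff' measurableSet_Ioo).2 (ae_of_all _ fun t ht => ?_)
    have htI : t ∈ Ico 0 T := ⟨by linarith [ht.1], lt_of_lt_of_le ht.2 h2⟩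
    exact ((hsol.contDiff_pressure htI).continuous.continuousOn.integrableOn_compact
      (isCompact_closedBall z.2 r)).mono_set ball_subset_closedBall
  have heq : abScaledSum r z u p G = abScaledSum r z u (fun t x => p t x - c t) G := by
    rw [abScaledSum, abScaledSum, hD]
  rw [heq]
  exact abScaledSum_le_typeIBound hr hz

/-- **Type-I rate ⇒ energy-Type-I on a final slab, with the given pressure** (`ν = 1`, `T ≥ 2`).
[cite: AlbrittonBarker2019, Lemma 2.5 and Remark 3.2] -/
theorem typeIBound_slab_lt_top_of_rate_two_le_pressure (hT2 : 2 ≤ T)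
    (hsol : IsClassicalNSSolutionOn (Ico 0 T) 1 0 u p) (hLH : IsLerayHopfOn T 1 0 (u 0) u)
    {C : ℝ} (hC : 0 ≤ C) (hrate : ∀ t ∈ Ico 0 T, ∀ x, ‖u t x‖ ≤ C / Real.sqrt (T - t)) :
    typeIBound (Ioo (T - 1 / 4) T ×ˢ (univ : Set (EuclideanSpace ℝ (Fin 3)))) u p
      (fun t x => fderiv ℝ (u t) x) < ⊤ :=
  lt_of_le_of_lt (typeIBound_le_typeIBound_sub_fun_time hsol (by linarith)
    (fun t => p t 0 - normalisedPressure (u t) 0) _)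
    (typeIBound_slab_lt_top_of_rate_two_le hT2 hsol hLH hC hrate)

/-! ### Lifespan `1`: Leray's similarity to lifespan `4` and back -/

/-- The gradient of Leray's rescaling is the rescaled gradient:
`∇(nsRescale c u) = c² • stPull (c²) c 0 0 ∇u` as space–time fields. [folklore] -/
theorem fderiv_nsRescale_eq (c : ℝ) (u : ℝ → EuclideanSpace ℝ (Fin 3) → EuclideanSpace ℝ (Fin 3)) :
    (fun s y => fderiv ℝ (nsRescale c u s) y) =
      c ^ 2 • stPull (c ^ 2) c 0 0 (fun s y => fderiv ℝ (u s) y) := by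
  funext s y
  have h1 : nsRescale c u s = c • stPull (c ^ 2) c 0 0 u s := by
    funext y'
    rw [nsRescale_apply]
    simp only [Pi.smul_apply, stPull_apply, zero_add]
  rw [h1, fderiv_const_smul_field, Pi.smul_apply, fderiv_stPull, smul_smul, ← pow_two]
  simp only [Pi.smul_apply, stPull_apply, zero_add]

/-- Leray's rescaling in the zoom vocabulary: `nsRescale c u = c • stPull (c²) c 0 0 u` and
`nsRescalePressure c p = c² • stPull (c²) c 0 0 p`. [folklore] -/
theorem nsRescale_eq_smul_stPull (c : ℝ) (u : ℝ → EuclideanSpace ℝ (Fin 3) → EuclideanSpace ℝ (Fin 3))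
    (p : ℝ → EuclideanSpace ℝ (Fin 3) → ℝ) :
    nsRescale c u = c • stPull (c ^ 2) c 0 0 u ∧ nsRescalePressure c p = c ^ 2 • stPull (c ^ 2) c 0 0 p := by
  constructor
  · funext s y
    rw [nsRescale_apply]
    simp only [Pi.smul_apply, stPull_apply, zero_add]
  · funext s y
    rw [nsRescalePressure_apply]
    simp only [Pi.smul_apply, stPull_apply, zero_add, smul_eq_mul]

/-- **Type-I rate on `[0, 1)` ⇒ energy-Type-I on the final slab `(15/16, 1) × ℝ³`** (`ν = 1`,
lifespan `1`), for a classical solution which is Leray–Hopf from its datum: rescale by Leray's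
similarity `w(s, y) = ½ u(s/4, y/2)` to lifespan `4`, apply
`typeIBound_slab_lt_top_of_rate_two_le_pressure`, and come back by `typeIBound_nsZoom`. [folklore] -/
theorem typeIBound_slab_lt_top_of_rate_one {u : ℝ → EuclideanSpace ℝ (Fin 3) → EuclideanSpace ℝ (Fin 3)}
    {p : ℝ → EuclideanSpace ℝ (Fin 3) → ℝ}
    (hsol : IsClassicalNSSolutionOn (Ico 0 1) 1 0 u p) (hLH : IsLerayHopfOn 1 1 0 (u 0) u)
    {C : ℝ} (hC : 0 ≤ C) (hrate : ∀ t ∈ Ico (0 : ℝ) 1, ∀ x, ‖u t x‖ ≤ C / Real.sqrt (1 - t)) :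
    typeIBound (Ioo (1 - 1 / 16) 1 ×ˢ (univ : Set (EuclideanSpace ℝ (Fin 3)))) u p
      (fun t x => fderiv ℝ (u t) x) < ⊤ := by
  set c : ℝ := 1 / 2 with hc
  have hcpos : 0 < c := by norm_num
  have hc2 : c ^ 2 = 1 / 4 := by norm_num
  -- (1) the rescaled solution on `[0, 4)`
  have hset : ((fun t => c ^ 2 * t) ⁻¹' Ico (0 : ℝ) 1) = Ico 0 4 := by
    ext t
    simp only [mem_preimage, mem_Ico, hc2]
    constructor
    · rintro ⟨h0, h1⟩; exact ⟨by linarith, by linarith⟩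
    · rintro ⟨h0, h1⟩; exact ⟨by linarith, by linarith⟩
  have hsolw : IsClassicalNSSolutionOn (Ico 0 4) 1 0 (nsRescale c u) (nsRescalePressure c p) := by
    have h := IsClassicalNSSolutionOn.nsRescale_holds hsol hcpos
    rwa [hset, nsRescaleForce_zero] at h
  have hw0 : nsRescaleData c (u 0) = nsRescale c u 0 := by
    funext x
    rw [nsRescale_apply, nsRescaleData_apply, mul_zero]
  have hLHw : IsLerayHopfOn 4 1 0 (nsRescale c u 0) (nsRescale c u) := by
    have h := IsLerayHopfOn.nsRescale_holds hLH hcpos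
    rwa [hc2, show (1 : ℝ) / (1 / 4) = 4 by norm_num, nsRescaleForce_zero, hw0] at h
  -- (2) the rate of the rescaled solution: `‖w(s, y)‖ = ½‖u(s/4, y/2)‖ ≤ C/√(4 - s)`
  have hratew : ∀ s ∈ Ico (0 : ℝ) 4, ∀ y, ‖nsRescale c u s y‖ ≤ C / Real.sqrt (4 - s) := by
    intro s hs y
    have hsI : c ^ 2 * s ∈ Ico (0 : ℝ) 1 := by rw [hc2]; exact ⟨by linarith [hs.1], by linarith [hs.2]⟩
    have hb := hrate (c ^ 2 * s) hsI (c • y)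
    rw [nsRescale_apply, norm_smul, Real.norm_eq_abs, abs_of_pos hcpos]
    have hsq : Real.sqrt (1 - c ^ 2 * s) = c * Real.sqrt (4 - s) := by
      rw [hc2, show (1 : ℝ) - 1 / 4 * s = (1 / 2) ^ 2 * (4 - s) by ring,
        Real.sqrt_mul (by norm_num), Real.sqrt_sq hcpos.le]
    rw [hsq] at hb
    have hsr : 0 < Real.sqrt (4 - s) := Real.sqrt_pos.2 (by linarith [hs.2])
    calc c * ‖u (c ^ 2 * s) (c • y)‖ ≤ c * (C / (c * Real.sqrt (4 - s))) :=
          mul_le_mul_of_nonneg_left hb hcpos.le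
      _ = C / Real.sqrt (4 - s) := by field_simp
  -- (3) the slab bound for `w` with its own pressure, and back by scale invariance
  have hIw := typeIBound_slab_lt_top_of_rate_two_le_pressure (T := 4) (by norm_num) hsolw hLHw hC hratew
  obtain ⟨hwu, hwp⟩ := nsRescale_eq_smul_stPull c u p
  have hpre : stAffine (c ^ 2) c 0 0 ⁻¹' (Ioo (1 - 1 / 16) 1 ×ˢ (univ : Set (EuclideanSpace ℝ (Fin 3)))) =
      Ioo (4 - 1 / 4) 4 ×ˢ (univ : Set (EuclideanSpace ℝ (Fin 3))) := by
    ext ⟨s, y⟩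
    simp only [mem_preimage, stAffine_apply, mem_prod, mem_Ioo, mem_univ, and_true, zero_add, hc2]
    constructor
    · rintro ⟨h0, h1⟩; exact ⟨by linarith, by linarith⟩
    · rintro ⟨h0, h1⟩; exact ⟨by linarith, by linarith⟩
  have key := typeIBound_nsZoom hcpos 0 0 (Ioo (1 - 1 / 16) 1 ×ˢ (univ : Set (EuclideanSpace ℝ (Fin 3))))
    u p (fun s y => fderiv ℝ (u s) y)
  rw [hpre, ← hwu, ← hwp, ← fderiv_nsRescale_eq] at key
  rw [← key]
  exact hIw

/-! ### The necessity of S₁ at unit scale -/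

/-- **Per solution at unit scale**: a maximal smooth unit-viscosity solution on `[0, 1)`, Leray–Hopf from a
rapidly decaying datum, with the Type-I rate at `1`, is energy-Type-I on a final slab with its own
pressure: `𝐈((1 - r², 1) × ℝ³; u, p, ∇u) < ⊤` for `r = 1/4`. [cite: AlbrittonBarker2019, Lemma 2.5 and Remark 3.2] -/
theorem energyTypeISlab_unit_of_isTypeIBlowup {u : ℝ → EuclideanSpace ℝ (Fin 3) → EuclideanSpace ℝ (Fin 3)}
    {p : ℝ → EuclideanSpace ℝ (Fin 3) → ℝ}
    (hmax : IsMaximalSmoothSolution 1 0 u p 1) (hLH : IsLerayHopfOn 1 1 0 (u 0) u)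
    (hdec : HasRapidSpatialDecay (u 0)) (hI : IsTypeIBlowup u 1) :
    ∃ r : ℝ, 0 < r ∧
      typeIBound (Ioo (1 - r ^ 2) 1 ×ˢ univ) u p (fun t y => fderiv ℝ (u t) y) < ⊤ := by
  -- sup bounds on closed sub-slabs, hence the rate on the whole of `[0, 1)`
  have hbdd : ∀ T' < (1 : ℝ), ∃ M : ℝ, ∀ t ∈ Icc 0 T', ∀ x, ‖u t x‖ ≤ M := by
    intro T' hT'
    obtain ⟨M, hM⟩ := exists_forall_norm_le_of_tao2011 tao2011_hasBoundedSobolevNormsOn_holds one_pos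
      hmax.1 hLH hdec (max T' (1 / 2)) ⟨lt_of_lt_of_le (by norm_num) (le_max_right _ _), max_lt hT' (by norm_num)⟩
    exact ⟨M, fun t ht x => hM t ⟨ht.1, ht.2.trans (le_max_left _ _)⟩ x⟩
  obtain ⟨C, hC⟩ := hI.exists_sqrt_mul_norm_le hbdd
  have hC0 : 0 ≤ max C 0 := le_max_right _ _
  have hrate : ∀ t ∈ Ico (0 : ℝ) 1, ∀ x, ‖u t x‖ ≤ max C 0 / Real.sqrt (1 - t) := by
    intro t ht x
    have hs : 0 < Real.sqrt (1 - t) := Real.sqrt_pos.2 (by linarith [ht.2])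
    rw [le_div_iff₀ hs, mul_comm]
    exact (hC t ht x).trans (le_max_left _ _)
  refine ⟨1 / 4, by norm_num, ?_⟩
  rw [show (1 : ℝ) - (1 / 4) ^ 2 = 1 - 1 / 16 by norm_num]
  exact typeIBound_slab_lt_top_of_rate_one hmax.1 hLH hC0 hrate

/-- **NECESSARY, by name: `NoTypeII ⇒ S₁` at unit scale.** Under the hard core, every maximal smooth
unit-viscosity solution on `[0, 1)`, Leray–Hopf from a rapidly decaying datum, is energy-Type-I on a final
slab (the `(ν, T) = (1, 1)` instance of the registered residual `stub_energyTypeISlab`). [folklore] -/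
theorem energyTypeISlab_unit_of_typeIliouvilleNoTypeII (hII : TypeIliouvilleNoTypeII) :
    ∀ (u : ℝ → EuclideanSpace ℝ (Fin 3) → EuclideanSpace ℝ (Fin 3))
      (p : ℝ → EuclideanSpace ℝ (Fin 3) → ℝ),
      IsMaximalSmoothSolution 1 0 u p 1 → IsLerayHopfOn 1 1 0 (u 0) u → HasRapidSpatialDecay (u 0) →
      ∃ r : ℝ, 0 < r ∧
        typeIBound (Ioo (1 - r ^ 2) 1 ×ˢ univ) u p (fun t y => fderiv ℝ (u t) y) < ⊤ :=
  fun u p hmax hLH hdec =>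
    energyTypeISlab_unit_of_isTypeIBlowup hmax hLH hdec (hII 1 1 one_pos one_pos u p hmax hLH hdec)

/-- **LOCATION of the registered residual: under EEL′, S₁ at unit scale IS the hard core.**  If the
pressure-free eternal energy Liouville statement EEL′ holds, then «every maximal smooth unit-viscosity
Leray–Hopf solution from a rapidly decaying datum is energy-Type-I on a final slab» is EQUIVALENT to
`NoTypeII` (⇒: `typeIliouvilleNoTypeII_of_energyTypeISlab_unit_of_eternalLiouville`; ⇐:
`energyTypeISlab_unit_of_typeIliouvilleNoTypeII`, unconditionally). [folklore] -/
theorem energyTypeISlab_unit_iff_typeIliouvilleNoTypeII_of_eternalLiouville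
    (hEEL : ∀ v : ℝ → EuclideanSpace ℝ (Fin 3) → EuclideanSpace ℝ (Fin 3),
      ContDiff ℝ (⊤ : ℕ∞) (uncurry v) → (∀ t, VectorCalculus.IsDivFree (v t)) →
      (∀ s t : ℝ, s < t → ∀ x, v t x = heatFlow (v s) (t - s) x - oseenDuhamel 1 s v v t x) →
      (∀ t x, ‖v t x‖ ≤ 2) →
      (∃ I : ℝ≥0∞, I ≠ ⊤ ∧ ∀ r : ℝ, 0 < r → ∀ z : ℝ × EuclideanSpace ℝ (Fin 3),
        cknAEss r z v ≤ I ∧ cknC r z v ≤ I ∧ cknE r z (fun s y => fderiv ℝ (v s) y) ≤ I) →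
      v 0 0 = 0) :
    (∀ (u : ℝ → EuclideanSpace ℝ (Fin 3) → EuclideanSpace ℝ (Fin 3))
      (p : ℝ → EuclideanSpace ℝ (Fin 3) → ℝ),
      IsMaximalSmoothSolution 1 0 u p 1 → IsLerayHopfOn 1 1 0 (u 0) u → HasRapidSpatialDecay (u 0) →
      ∃ r : ℝ, 0 < r ∧
        typeIBound (Ioo (1 - r ^ 2) 1 ×ˢ univ) u p (fun t y => fderiv ℝ (u t) y) < ⊤) ↔
    TypeIliouvilleNoTypeII :=
  ⟨fun hS => typeIliouvilleNoTypeII_of_energyTypeISlab_unit_of_eternalLiouville hS hEEL,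
    energyTypeISlab_unit_of_typeIliouvilleNoTypeII⟩

end Summit.NavierStokesRegularity.NavierStokesRegularity.Theorems.TypeIliouvilleNoTypeII.EnergySlab

end
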